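import Literature.RingTheory.AlgebraicIndependent.TranscendentalLifts
import Mathlib.RingTheory.WittVector.Complete
import Mathlib.RingTheory.WittVector.Compare
import Mathlib.RingTheory.WittVector.Domain
import Mathlib.RingTheory.WittVector.DiscreteValuationRing
import Mathlib.RingTheory.Smooth.AdicCompletion
import Mathlib.Logic.Function.Basic
import HarnessLib

/-!
# Lifting residues to Witt vectors: algebraically independent lifts and Hensel lifts of smooth points

Topic `Literature/RingTheory/CompleteLocalRings` (the Witt ring `W(κ)` is the Cohen ring of the
perfect field `κ`). The two lifting steps of Cassels' embedding theorem (J. W. S. Cassels, *An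
embedding theorem for fields*, Bull. Austral. Math. Soc. 14 (1976), proof of Thm. I: "choose
`ξ_j ∈ ℤ_p` algebraically independent with `ξ_j ≡ a_j`", and "by Hensel's lemma the root `θ̄` of
`H(a, Y) mod p` lifts to a root of `H(ξ, Y)` in `ℤ_p`"), with `ℤ_p` replaced by the ring of Witt
vectors `W(κ)` of a perfect ring `κ` of characteristic `p`:

* `charZero_wittVector` — `W(κ)` has characteristic zero (`κ` non-trivial of characteristic `p`);
* `not_countable_preimage_coeff_zero` — every residue class `{x : W(κ) | x₀ = b}` is uncountable
  (it contains a copy of `{0,1}^ℕ` in the higher Witt coordinates; Cantor);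
* `exists_algebraicIndependent_lift_wittVector` — prescribed residues `a : ι → κ` (finite `ι`) have
  lifts `u : ι → W(κ)` algebraically independent over `ℤ`
  (`AlgebraicIndependent.exists_algebraicIndependent_lift`);
* `exists_algHom_wittVector_of_formallySmooth` — **Hensel lift of a smooth point**: for a ring
  `Λ → W(κ)` and a formally smooth `Λ`-algebra `A`, every ring map `A → κ` compatible with
  `Λ → W(κ) → κ` lifts to a `Λ`-algebra map `A → W(κ)` (`W(κ)` is `p`-adically complete, Mathlib
  `WittVector.isAdicCompleteIdealSpanP`, and formally smooth maps lift through complete ideals,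
  Mathlib `Algebra.FormallySmooth.exists_mkₐ_comp_eq_of_isAdicComplete`).

## References

* [Cassels1976] J. W. S. Cassels, An embedding theorem for fields, Bull. Austral. Math. Soc. 14
  (1976) 193–198, proof of Thm. I.
* [Matsumura1987] H. Matsumura, Commutative Ring Theory, CUP, Thm. 29.2 and its proof (lifting
  into complete local rings along smooth maps).
-/

noncomputable section

universe u v w

namespace Literature.RingTheory.CompleteLocalRings

open Literature.RingTheory.AlgebraicIndependent

section WittFacts

variable (p : ℕ) [hp : Fact p.Prime] (κ : Type v) [CommRing κ]

/-- **`W(κ)` has characteristic zero** for `κ` a non-trivial ring of characteristic `p`: it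
contains `W(𝔽_p) ≅ ℤ_p` (Mathlib `WittVector.equiv`) via the injective `WittVector.map` of
`𝔽_p → κ`. [cite: Matsumura1987, §29 (p-rings; Thm. 29.2)] -/
theorem charZero_wittVector [Nontrivial κ] [CharP κ p] : CharZero (WittVector p κ) := by
  haveI : CharZero (WittVector p (ZMod p)) :=
    charZero_of_injective_ringHom (f := (WittVector.equiv p).symm.toRingHom)
      (WittVector.equiv p).symm.injective
  exact charZero_of_injective_ringHom (f := WittVector.map (ZMod.castHom (dvd_refl p) κ))
    (WittVector.map_injective _ (ZMod.castHom (dvd_refl p) κ).injective)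

omit hp in
/-- **Residue classes of `W(κ)` are uncountable**: for every `b ∈ κ` (`κ` non-trivial), the set of
Witt vectors with zeroth coordinate `b` is not countable — the higher coordinates embed `{0,1}^ℕ`,
i.e. the power set of `ℕ`, and Cantor's theorem forbids an injection of that into `ℕ` (Cassels
1976, proof of Thm. I: "`ℤ_p` is uncountable"). [cite: Cassels1976, proof of Thm. I] -/
theorem not_countable_preimage_coeff_zero [Nontrivial κ] (b : κ) :
    ¬ ((fun x : WittVector p κ => x.coeff 0) ⁻¹' {b}).Countable := by
  classical
  intro hc
  set F : Set (WittVector p κ) := (fun x : WittVector p κ => x.coeff 0) ⁻¹' {b} with hF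
  obtain ⟨f, hf⟩ := Set.countable_iff_exists_injective.mp hc
  -- `S ↦ (b, 𝟙_S(0), 𝟙_S(1), …)` embeds the power set of `ℕ` into the residue class of `b`
  let c : Set ℕ → ℕ → κ := fun S n =>
    match n with
    | 0 => b
    | m + 1 => if m ∈ S then 1 else 0
  let w : Set ℕ → WittVector p κ := fun S => WittVector.mk p (c S)
  have hw : ∀ S, w S ∈ F := fun S => by
    simp only [hF, Set.mem_preimage, Set.mem_singleton_iff, w, WittVector.coeff_mk, c]
  let g : Set ℕ → F := fun S => ⟨w S, hw S⟩
  have hg : Function.Injective g := by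
    intro S T hST
    have hST' : w S = w T := congrArg Subtype.val hST
    ext m
    have hm := congrArg (fun x : WittVector p κ => x.coeff (m + 1)) hST'
    simp only [w, WittVector.coeff_mk, c] at hm
    by_cases hS : m ∈ S <;> by_cases hT : m ∈ T <;> simp_all
  exact Function.cantor_injective (f ∘ g) (hf.comp hg)

/-- **Algebraically independent lifts of prescribed residues in `W(κ)`** (Cassels 1976, proof of
Thm. I, with `ℤ_p` replaced by `W(κ)`): for `κ` an integral domain of characteristic `p` and any
finite family of residues `a : ι → κ`, there are Witt vectors `u_i` with zeroth coordinate `a_i`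
which are algebraically independent over `ℤ` — `W(κ)` is a domain of characteristic zero and each
residue class is uncountable (`not_countable_preimage_coeff_zero`), so
`AlgebraicIndependent.exists_algebraicIndependent_lift` applies. [cite: Cassels1976, proof of Thm. I] -/
theorem exists_algebraicIndependent_lift_wittVector [IsDomain κ] [CharP κ p]
    (ι : Type u) [Finite ι] (a : ι → κ) :
    ∃ u : ι → WittVector p κ, AlgebraicIndependent ℤ u ∧ ∀ i, (u i).coeff 0 = a i := by
  haveI : CharZero (WittVector p κ) := charZero_wittVector p κ
  haveI : FaithfulSMul ℤ (WittVector p κ) :=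
    (faithfulSMul_iff_algebraMap_injective ℤ (WittVector p κ)).mpr
      (algebraMap ℤ (WittVector p κ)).injective_int
  exact exists_algebraicIndependent_lift ℤ (fun x : WittVector p κ => x.coeff 0)
    (not_countable_preimage_coeff_zero p κ) ι a

end WittFacts

/-! ## Hensel lifts of smooth points into `W(κ)` -/

section Hensel

variable {p : ℕ} [hp : Fact p.Prime] {κ : Type v} [CommRing κ] [CharP κ p] [PerfectRing κ p]
variable {Λ : Type u} [CommRing Λ] [Algebra Λ (WittVector p κ)]
variable {A : Type w} [CommRing A] [Algebra Λ A]

/-- **Hensel lift of a smooth point into the Witt ring** (Cassels 1976, proof of Thm. I, Hensel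
step; Matsumura Thm. 29.2: maps from smooth algebras lift into complete local rings). Let
`Λ → W(κ)` be a ring map (`κ` perfect of characteristic `p`), `A` a formally smooth `Λ`-algebra and
`x̄ : A → κ` a ring map compatible with `Λ → W(κ) → κ`. Then `x̄` lifts to a `Λ`-algebra map
`x : A → W(κ)` with zeroth Witt coordinate `x̄`. Proof: `W(κ)/p ≅ κ` (Mathlib
`WittVector.quotientPEquiv`), `W(κ)` is `p`-adically complete (`WittVector.isAdicCompleteIdealSpanP`)
and formally smooth algebras lift through adically complete ideals
(`Algebra.FormallySmooth.exists_mkₐ_comp_eq_of_isAdicComplete`). [cite: Matsumura1987, Thm. 29.2] -/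
theorem exists_algHom_wittVector_of_formallySmooth [Algebra.FormallySmooth Λ A] (xbar : A →+* κ)
    (hx : ∀ l : Λ, xbar (algebraMap Λ A l) = WittVector.constantCoeff (algebraMap Λ (WittVector p κ) l)) :
    ∃ x : A →ₐ[Λ] WittVector p κ, ∀ a : A, (x a).coeff 0 = xbar a := by
  set I : Ideal (WittVector p κ) := Ideal.span {(p : WittVector p κ)} with hI
  let e : WittVector p κ ⧸ I ≃+* κ := WittVector.quotientPEquiv
  have he : ∀ y : WittVector p κ, e (Ideal.Quotient.mk I y) = WittVector.constantCoeff y :=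
    fun y => WittVector.quotientPEquiv_mk y
  -- the point `x̄` as a `Λ`-algebra map `A → W(κ)/p`
  let f₀ : A →+* WittVector p κ ⧸ I := e.symm.toRingHom.comp xbar
  have hf₀ : ∀ l : Λ, f₀ (algebraMap Λ A l) = algebraMap Λ (WittVector p κ ⧸ I) l := by
    intro l
    change e.symm (xbar (algebraMap Λ A l)) = Ideal.Quotient.mk I (algebraMap Λ (WittVector p κ) l)
    rw [hx, ← he, RingEquiv.symm_apply_apply]
  let f : A →ₐ[Λ] WittVector p κ ⧸ I := { f₀ with commutes' := hf₀ }
  obtain ⟨g, hg⟩ := Algebra.FormallySmooth.exists_mkₐ_comp_eq_of_isAdicComplete (I := I) f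
  refine ⟨g, fun a => ?_⟩
  have h1 : Ideal.Quotient.mk I (g a) = f a := by
    rw [← hg]; rfl
  have h2 : e (Ideal.Quotient.mk I (g a)) = xbar a := by
    rw [h1]
    change e (e.symm (xbar a)) = xbar a
    exact e.apply_symm_apply _
  rw [he] at h2
  exact h2

end Hensel

end Literature.RingTheory.CompleteLocalRings

end
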